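import Summits.NavierStokesRegularity.NavierStokesRegularity.Theorems.TypeIIInviscidRelaxationAxisymSwirlRegularZhangBarrierProfileBoundsW
import Summits.NavierStokesRegularity.NavierStokesRegularity.Theorems.TypeIIInviscidRelaxationAxisymSwirlRegularZhangBarrier
import HarnessLib

/-!
# The κ-inflow barriers, `κ ∈ (0,1]`: the barrier and the κ-INFLOW CRITERION, unconditional

Helper toward the crux `AxisymSwirlRegular` (stmt-NavierStokesRegularity-1964, route TypeIIInviscidRelaxation),
registered line `radial_inflow_split`, criterion side (⟨19059⟩); last of the κ-chain
`…RiccatiW` / `…RiccatiWCalc` / `…ProfileW` / `…ProfileBoundsW` / this file (the κ-analogue of `…ZhangBarrier`).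

THIS FILE:
* `barrierW κ M T Λ r t = Λ (T−t)^{m_W} F_W(r (T−t)^{−1/2})`, its derivatives, and the barrier inequality
  `w_rr − w_r/r + M r^{κ−1}(T−t)^{−κ/2} w_r ≤ w_t` (`barrierW_pde`; the envelope is self-similar:
  `M r^{κ−1}(T−t)^{−κ/2} · w_r = Λσρ² · Mξ^{κ−1}F′(ξ)`, `ξ = rρ`);
* `exists_halfLineBarrierW` — for `0 < κ ≤ 1`, `M, T > 0` the full clause list of the time-dependent half-line
  barrier demanded by `RadialInflowComparisonT.hasSmoothExtensionPast_of_kappaEnvelope` (the ideator's O1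
  `HalfLineBarrierAt κ M T`), with `α = 2m_W ∈ (0, κ]`;
* **`hasSmoothExtensionPast_of_kappaEnvelope_holds`** — the κ-INFLOW CRITERION of the ideator line `kappa-inflow`
  (ns-idea-4) as an UNCONDITIONAL tree theorem for every `κ ∈ (0,1]`, `M > 0`, `ν > 0`: an axisymmetric classical
  Leray–Hopf solution on `[0,T)` at viscosity `ν` from a rapidly decaying datum with
  `u_r ≥ −M ν^{1−κ/2} r^{κ−1} (T−t)^{−κ/2}` on the unit tube `0 < r ≤ 1` extends smoothly past `T`.
  At `κ = 1` this is Zhang's partial Type I criterion (`hasSmoothExtensionPast_of_sqrtEnvelope`); for `κ ∈ (0,1)`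
  the envelopes interpolate between Zhang's `(T−t)^{−1/2}` and the scale-critical `r^{−1}` of ⟨19059⟩ (where only
  `M < 2` is reachable, `RadialInflowBarrierWall.exists_isTubeBarrier_iff_lt_two`) — with NO restriction on `M`.
  To our knowledge these mixed one-sided criteria are not in print (ideator card LINE-kappa-inflow: nearest is the
  two-sided, any-constant family of Chen–Strain–Tsai–Yau II).

Honest label: regularity CRITERIA (conditional on a one-sided envelope hypothesis), not an a-priori bound; the
crux ⟨1964⟩ and its registered stubs are untouched.

References: Qi S. Zhang, arXiv:2604.07785 (2026) [Zhang2026PartialTypeI]; C.-C. Chen, R. M. Strain, T.-P. Tsai,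
H.-T. Yau, Comm. PDE 34 (2009) [ChenStrainTsaiYau2009]. [new]
-/

noncomputable section

set_option linter.dupNamespace false

open Set Filter Topology Real

namespace Summit.NavierStokesRegularity.NavierStokesRegularity.Theorems.ZhangBarrier

/-- Time factor `σ_W(t) = (T−t)^{m_W}` as `exp(m_W log(T−t))`. [new] -/
def sigW (κ M T t : ℝ) : ℝ := exp (expoW κ M * log (T - t))

/-- **The κ-barrier** `w(r,t) = Λ (T−t)^{m_W} F_W(r (T−t)^{−1/2})`. [new] -/
def barrierW (κ M T Λ r t : ℝ) : ℝ := Λ * sigW κ M T t * profW κ M (r * rho T t)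

/-- `σ_W > 0`. -/
theorem sigW_pos (κ M T t : ℝ) : 0 < sigW κ M T t := exp_pos _

/-- `σ_W · ρ^{2m_W} = 1`. -/
theorem sigW_mul_rho_rpow (κ M T t : ℝ) : sigW κ M T t * rho T t ^ (2 * expoW κ M) = 1 := by
  unfold sigW rho
  rw [← exp_mul, ← exp_add, show expoW κ M * log (T - t) + -(log (T - t) / 2) * (2 * expoW κ M) = 0 by ring,
    exp_zero]

/-- The envelope is self-similar: `r^{κ−1} (T−t)^{−κ/2} = ρ · (rρ)^{κ−1}`, `ρ = (T−t)^{−1/2}`. -/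
theorem envelope_selfsimilar {κ T t r : ℝ} (hs : 0 < T - t) (hr : 0 < r) :
    r ^ (κ - 1) * (T - t) ^ (-(κ / 2)) = rho T t * (r * rho T t) ^ (κ - 1) := by
  have hρ : 0 < rho T t := rho_pos T t
  rw [mul_rpow hr.le hρ.le]
  unfold rho
  rw [← exp_mul, rpow_def_of_pos hs]
  have e : -(log (T - t) / 2) + -(log (T - t) / 2) * (κ - 1) = log (T - t) * -(κ / 2) := by ring
  rw [← e, exp_add]
  ring

/-- `∂_r w = Λσρ F′(rρ)` at `r > 0`. -/
theorem hasDerivAt_barrierW_r {κ M : ℝ} (hκ0 : 0 < κ) (hκ1 : κ ≤ 1) (hM : 0 < M) (T Λ t : ℝ) {r : ℝ}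
    (hr : 0 < r) :
    HasDerivAt (fun r' => barrierW κ M T Λ r' t) (Λ * sigW κ M T t * rho T t * dprofW κ M (r * rho T t)) r := by
  have hρ := rho_pos T t
  have h1 : HasDerivAt (fun r' => r' * rho T t) (1 * rho T t) r := (hasDerivAt_id' r).mul_const _
  have h2 := (hasDerivAt_profW hκ0 hκ1 hM (mul_pos hr hρ)).comp r h1
  have h3 := h2.const_mul (Λ * sigW κ M T t)
  exact h3.congr_deriv (by ring)

/-- `∂_r(Λσρ F′(rρ)) = Λσρ² F″(rρ)` at `r > 0`. -/
theorem hasDerivAt_dbarrierW_r {κ M : ℝ} (hκ0 : 0 < κ) (hκ1 : κ ≤ 1) (hM : 0 < M) (T Λ t : ℝ) {r : ℝ}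
    (hr : 0 < r) :
    HasDerivAt (fun r' => Λ * sigW κ M T t * rho T t * dprofW κ M (r' * rho T t))
      (Λ * sigW κ M T t * rho T t ^ 2 * ddprofW κ M (r * rho T t)) r := by
  have hρ := rho_pos T t
  have h1 : HasDerivAt (fun r' => r' * rho T t) (1 * rho T t) r := (hasDerivAt_id' r).mul_const _
  have h2 := (hasDerivAt_dprofW hκ0 hκ1 hM (mul_pos hr hρ)).comp r h1
  have h3 := h2.const_mul (Λ * sigW κ M T t * rho T t)
  exact h3.congr_deriv (by ring)

/-- `deriv_r w` at `r > 0`. -/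
theorem deriv_barrierW_r {κ M : ℝ} (hκ0 : 0 < κ) (hκ1 : κ ≤ 1) (hM : 0 < M) (T Λ t : ℝ) {r : ℝ} (hr : 0 < r) :
    deriv (fun r' => barrierW κ M T Λ r' t) r = Λ * sigW κ M T t * rho T t * dprofW κ M (r * rho T t) :=
  (hasDerivAt_barrierW_r hκ0 hκ1 hM T Λ t hr).deriv

/-- `iteratedDeriv 2` in `r` at `r > 0`. -/
theorem iteratedDeriv_two_barrierW_r {κ M : ℝ} (hκ0 : 0 < κ) (hκ1 : κ ≤ 1) (hM : 0 < M) (T Λ t : ℝ) {r : ℝ}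
    (hr : 0 < r) :
    iteratedDeriv 2 (fun r' => barrierW κ M T Λ r' t) r
      = Λ * sigW κ M T t * rho T t ^ 2 * ddprofW κ M (r * rho T t) := by
  rw [show (2 : ℕ) = 1 + 1 from rfl, iteratedDeriv_succ, iteratedDeriv_one]
  have hev : deriv (fun r' => barrierW κ M T Λ r' t)
      =ᶠ[𝓝 r] fun r' => Λ * sigW κ M T t * rho T t * dprofW κ M (r' * rho T t) := by
    filter_upwards [Ioi_mem_nhds hr] with r' hr' using deriv_barrierW_r hκ0 hκ1 hM T Λ t hr'
  rw [hev.deriv_eq]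
  exact (hasDerivAt_dbarrierW_r hκ0 hκ1 hM T Λ t hr).deriv

/-- `∂_t w = Λσρ²((ξ/2)F′(ξ) − m F(ξ))`, `ξ = rρ`, at `r > 0`, `t < T`. -/
theorem hasDerivAt_barrierW_t {κ M : ℝ} (hκ0 : 0 < κ) (hκ1 : κ ≤ 1) (hM : 0 < M) (T Λ : ℝ) {r t : ℝ}
    (hr : 0 < r) (hs : 0 < T - t) :
    HasDerivAt (fun s => barrierW κ M T Λ r s)
      (Λ * sigW κ M T t * rho T t ^ 2 *
        (r * rho T t / 2 * dprofW κ M (r * rho T t) - expoW κ M * profW κ M (r * rho T t))) t := by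
  have hρ := rho_pos T t
  have hL : HasDerivAt (fun s => log (T - s)) ((0 - 1) / (T - t)) t :=
    ((hasDerivAt_const t T).sub (hasDerivAt_id' t)).log hs.ne'
  have hσ : HasDerivAt (fun s => exp (expoW κ M * log (T - s)))
      (exp (expoW κ M * log (T - t)) * (expoW κ M * ((0 - 1) / (T - t)))) t := (hL.const_mul _).exp
  have hρ' : HasDerivAt (fun s => exp (-(log (T - s) / 2)))
      (exp (-(log (T - t) / 2)) * (-((0 - 1) / (T - t) / 2))) t := (hL.div_const 2).neg.exp
  have hξ : 0 < r * exp (-(log (T - t) / 2)) := by positivity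
  have hP0 := (hasDerivAt_profW hκ0 hκ1 hM hξ).comp t (hρ'.const_mul r)
  have hP : HasDerivAt (fun s => profW κ M (r * exp (-(log (T - s) / 2))))
      (dprofW κ M (r * exp (-(log (T - t) / 2))) * (r * (exp (-(log (T - t) / 2)) * (-((0 - 1) / (T - t) / 2))))) t :=
    hP0
  have hw : HasDerivAt (fun s => Λ * exp (expoW κ M * log (T - s)) * profW κ M (r * exp (-(log (T - s) / 2))))
      (Λ * (exp (expoW κ M * log (T - t)) * (expoW κ M * ((0 - 1) / (T - t)))) * profW κ M (r * exp (-(log (T - t) / 2)))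
        + Λ * exp (expoW κ M * log (T - t))
          * (dprofW κ M (r * exp (-(log (T - t) / 2))) * (r * (exp (-(log (T - t) / 2)) * (-((0 - 1) / (T - t) / 2)))))) t :=
    (hσ.const_mul Λ).mul hP
  refine hw.congr_deriv ?_
  have h2 := rho_sq (T := T) hs
  unfold rho at h2
  unfold sigW rho
  linear_combination (-(Λ * exp (expoW κ M * log (T - t))
    * (r * exp (-(log (T - t) / 2)) / 2 * dprofW κ M (r * exp (-(log (T - t) / 2)))
        - expoW κ M * profW κ M (r * exp (-(log (T - t) / 2)))))) * h2

/-- `deriv_t w` at `r > 0`, `t < T`. -/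
theorem deriv_barrierW_t {κ M : ℝ} (hκ0 : 0 < κ) (hκ1 : κ ≤ 1) (hM : 0 < M) (T Λ : ℝ) {r t : ℝ}
    (hr : 0 < r) (hs : 0 < T - t) :
    deriv (fun s => barrierW κ M T Λ r s) t = Λ * sigW κ M T t * rho T t ^ 2 *
        (r * rho T t / 2 * dprofW κ M (r * rho T t) - expoW κ M * profW κ M (r * rho T t)) :=
  (hasDerivAt_barrierW_t hκ0 hκ1 hM T Λ hr hs).deriv

/-- **The κ-barrier inequality** `w_rr − w_r/r + M r^{κ−1}(T−t)^{−κ/2} w_r ≤ w_t` (`r > 0`, `t < T`):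
`Λσρ² · (F″ + (Mξ^{κ−1} − 1/ξ − ξ/2)F′ + mF)(rρ) ≤ 0` by `profileW_ineq` and `envelope_selfsimilar`. [new] -/
theorem barrierW_pde {κ M T Λ r t : ℝ} (hκ0 : 0 < κ) (hκ1 : κ ≤ 1) (hM : 0 < M) (hΛ : 0 < Λ) (hr : 0 < r)
    (ht : t < T) :
    iteratedDeriv 2 (fun ρ => barrierW κ M T Λ ρ t) r - r⁻¹ * deriv (fun ρ => barrierW κ M T Λ ρ t) r
      + M * r ^ (κ - 1) * (T - t) ^ (-(κ / 2)) * deriv (fun ρ => barrierW κ M T Λ ρ t) r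
      ≤ deriv (fun s => barrierW κ M T Λ r s) t := by
  have hs : 0 < T - t := by linarith
  rw [iteratedDeriv_two_barrierW_r hκ0 hκ1 hM T Λ t hr, deriv_barrierW_r hκ0 hκ1 hM T Λ t hr,
    deriv_barrierW_t hκ0 hκ1 hM T Λ hr hs, mul_assoc M, envelope_selfsimilar (κ := κ) hs hr]
  set ρ := rho T t with hρdef
  set σ := sigW κ M T t with hσdef
  have hρ : 0 < ρ := rho_pos T t
  have hσ : 0 < σ := sigW_pos κ M T t
  have hξ : 0 < r * ρ := mul_pos hr hρ
  have key := profileW_ineq hκ0 hκ1 hM hξ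
  have hK : 0 < Λ * σ * ρ ^ 2 := by positivity
  rw [← sub_nonneg]
  have e : Λ * σ * ρ ^ 2 * (r * ρ / 2 * dprofW κ M (r * ρ) - expoW κ M * profW κ M (r * ρ))
      - (Λ * σ * ρ ^ 2 * ddprofW κ M (r * ρ) - r⁻¹ * (Λ * σ * ρ * dprofW κ M (r * ρ))
        + M * (ρ * (r * ρ) ^ (κ - 1)) * (Λ * σ * ρ * dprofW κ M (r * ρ)))
      = -(Λ * σ * ρ ^ 2) * (ddprofW κ M (r * ρ) + (M * (r * ρ) ^ (κ - 1) - (r * ρ)⁻¹ - r * ρ / 2) * dprofW κ M (r * ρ)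
        + expoW κ M * profW κ M (r * ρ)) := by
    field_simp
    ring
  rw [e]
  exact mul_nonneg_of_nonpos_of_nonpos (by linarith) key

/-- Joint smoothness of `w` on `(0,∞) × (−∞,T)`. -/
theorem contDiffOn_barrierW {κ M : ℝ} (T Λ : ℝ) {n : WithTop ℕ∞} :
    ContDiffOn ℝ n (fun q : ℝ × ℝ => barrierW κ M T Λ q.1 q.2) (Ioi 0 ×ˢ Iio T) := by
  have hsub : ∀ q ∈ (Ioi 0 ×ˢ Iio T : Set (ℝ × ℝ)), T - q.2 ≠ 0 := by
    intro q hq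
    have : q.2 < T := (mem_prod.1 hq).2
    linarith
  have h1 : ContDiffOn ℝ n (fun q : ℝ × ℝ => T - q.2) (Ioi 0 ×ˢ Iio T) := by fun_prop
  have hlog : ContDiffOn ℝ n (fun q : ℝ × ℝ => log (T - q.2)) (Ioi 0 ×ˢ Iio T) := h1.log hsub
  have hsig : ContDiffOn ℝ n (fun q : ℝ × ℝ => exp (expoW κ M * log (T - q.2))) (Ioi 0 ×ˢ Iio T) :=
    (contDiffOn_const.mul hlog).exp
  have hrho : ContDiffOn ℝ n (fun q : ℝ × ℝ => exp (-(log (T - q.2) / 2))) (Ioi 0 ×ˢ Iio T) :=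
    (hlog.div_const 2).neg.exp
  have harg : ContDiffOn ℝ n (fun q : ℝ × ℝ => q.1 * exp (-(log (T - q.2) / 2))) (Ioi 0 ×ˢ Iio T) :=
    contDiffOn_fst.mul hrho
  have hmaps : MapsTo (fun q : ℝ × ℝ => q.1 * exp (-(log (T - q.2) / 2))) (Ioi 0 ×ˢ Iio T) (Ioi 0) := by
    intro q hq
    have : 0 < q.1 := (mem_prod.1 hq).1
    exact mul_pos this (exp_pos _)
  have hprof : ContDiffOn ℝ n (fun q : ℝ × ℝ => profW κ M (q.1 * exp (-(log (T - q.2) / 2)))) (Ioi 0 ×ˢ Iio T) :=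
    (contDiffOn_profW κ M).comp harg hmaps
  exact (contDiffOn_const (c := Λ)).mul hsig |>.mul hprof

/-- Joint continuity of `w` on `ℝ × (−∞,T)`. -/
theorem continuousOn_barrierW {κ M : ℝ} (hκ0 : 0 < κ) (hκ1 : κ ≤ 1) (T Λ : ℝ) :
    ContinuousOn (fun q : ℝ × ℝ => barrierW κ M T Λ q.1 q.2) (univ ×ˢ Iio T) := by
  have hsub : ∀ q ∈ (univ ×ˢ Iio T : Set (ℝ × ℝ)), T - q.2 ≠ 0 := by
    intro q hq
    have : q.2 < T := (mem_prod.1 hq).2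
    linarith
  have h1 : ContinuousOn (fun q : ℝ × ℝ => T - q.2) (univ ×ˢ Iio T) := by fun_prop
  have hlog : ContinuousOn (fun q : ℝ × ℝ => log (T - q.2)) (univ ×ˢ Iio T) := h1.log hsub
  have hsig : ContinuousOn (fun q : ℝ × ℝ => Λ * exp (expoW κ M * log (T - q.2))) (univ ×ˢ Iio T) :=
    continuousOn_const.mul (continuousOn_const.mul hlog).rexp
  have hrho : ContinuousOn (fun q : ℝ × ℝ => exp (-(log (T - q.2) / 2))) (univ ×ˢ Iio T) :=
    (hlog.div_const 2).neg.rexp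
  have harg : ContinuousOn (fun q : ℝ × ℝ => q.1 * exp (-(log (T - q.2) / 2))) (univ ×ˢ Iio T) :=
    continuousOn_fst.mul hrho
  have hprof := (continuous_profW (M := M) hκ0 hκ1).comp_continuousOn harg
  exact hsig.mul hprof

/-- **The explicit half-line barrier for the κ-envelope `M r^{κ−1}(T−t)^{−κ/2}`**, full clause list (the hypothesis
`hB` of `RadialInflowComparisonT.hasSmoothExtensionPast_of_kappaEnvelope` with horizon `T`). [new] -/
theorem exists_halfLineBarrierW (κ M T : ℝ) (hκ0 : 0 < κ) (hκ1 : κ ≤ 1) (hM : 0 < M) (hT : 0 < T) :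
    ∃ (α C : ℝ) (w : ℝ → ℝ → ℝ), 0 < α ∧ α ≤ 1 ∧ 0 < C ∧
      ContDiffOn ℝ 2 (fun q : ℝ × ℝ => w q.1 q.2) (Ioo 0 2 ×ˢ Ioo 0 T) ∧
      ContinuousOn (fun q : ℝ × ℝ => w q.1 q.2) (Icc 0 2 ×ˢ Ico 0 T) ∧
      (∀ t ∈ Ico 0 T, w 0 t = 0 ∧ MonotoneOn (fun r => w r t) (Icc 0 2) ∧
        (∀ r ∈ Icc (0 : ℝ) 1, w r t ≤ C * r ^ α) ∧ 1 ≤ w 1 t) ∧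
      (∀ r ∈ Icc (0 : ℝ) 2, min r 1 ^ 2 ≤ w r 0) ∧
      (∀ r ∈ Ioo (0 : ℝ) 2, ∀ t ∈ Ioo 0 T,
        iteratedDeriv 2 (fun ρ => w ρ t) r - r⁻¹ * deriv (fun ρ => w ρ t) r
            + M * r ^ (κ - 1) * (T - t) ^ (-(κ / 2)) * deriv (fun ρ => w ρ t) r
          ≤ deriv (fun s => w r s) t) := by
  set m := expoW κ M with hm_def
  have hm : 0 < m := expoW_pos hκ0 hM
  set ρ₀ := rho T 0 with hρ₀_def
  have hρ₀ : 0 < ρ₀ := rho_pos T 0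
  set σ₀ := sigW κ M T 0 with hσ₀_def
  have hσ₀ : 0 < σ₀ := sigW_pos κ M T 0
  set κ₁ := kappa1W κ M ρ₀ with hκ₁_def
  have hκ₁ : 0 < κ₁ := kappa1W_pos hκ0 hM hρ₀
  set κ₂ := kappa2W κ M (2 * ρ₀) with hκ₂_def
  have hκ₂ : 0 < κ₂ := kappa2W_pos (ξ₂ := 2 * ρ₀) hκ0 hM
  obtain ⟨Λ, hΛ_def⟩ : ∃ Λ : ℝ, Λ = 1 / κ₁ + T / (σ₀ * κ₂) := ⟨_, rfl⟩
  have hΛ : 0 < Λ := by rw [hΛ_def]; positivity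
  have hΛ1 : 1 / κ₁ ≤ Λ := by
    rw [hΛ_def]; exact le_add_of_nonneg_right (by positivity)
  have hΛ2 : T / (σ₀ * κ₂) ≤ Λ := by
    rw [hΛ_def]; exact le_add_of_nonneg_left (by positivity)
  have h2m : 2 * m ≤ 1 := (two_expoW_le hκ0 hM).trans hκ1
  refine ⟨2 * m, Λ * C0W κ M, barrierW κ M T Λ, by positivity, h2m,
    mul_pos hΛ (C0W_pos hκ0 hM), ?_, ?_, ?_, ?_, ?_⟩
  · exact (contDiffOn_barrierW T Λ).mono (prod_mono Ioo_subset_Ioi_self Ioo_subset_Iio_self)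
  · exact (continuousOn_barrierW hκ0 hκ1 T Λ).mono (prod_mono (subset_univ _) Ico_subset_Iio_self)
  · intro t ht
    have hs : 0 < T - t := by linarith [ht.2]
    have hρ : 0 < rho T t := rho_pos T t
    have hσ : 0 < sigW κ M T t := sigW_pos κ M T t
    refine ⟨?_, ?_, ?_, ?_⟩
    · simp [barrierW, profW_zero hκ0]
    · intro r₁ hr₁ r₂ hr₂ h12
      simp only [barrierW]
      apply mul_le_mul_of_nonneg_left _ (by positivity)
      exact monotoneOn_profW hκ0 hκ1 hM (show (0:ℝ) ≤ r₁ * rho T t by have := hr₁.1; positivity)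
        (show (0:ℝ) ≤ r₂ * rho T t by have := hr₂.1; positivity)
        (mul_le_mul_of_nonneg_right h12 hρ.le)
    · intro r hr
      simp only [barrierW]
      have hξ0 : 0 ≤ r * rho T t := by have := hr.1; positivity
      have hb := profW_le hκ0 hκ1 hM hξ0
      have hsplit : (r * rho T t) ^ (2 * expoW κ M) = r ^ (2 * expoW κ M) * rho T t ^ (2 * expoW κ M) :=
        mul_rpow hr.1 hρ.le
      have h1 := sigW_mul_rho_rpow κ M T t
      calc Λ * sigW κ M T t * profW κ M (r * rho T t)
          ≤ Λ * sigW κ M T t * (C0W κ M * (r * rho T t) ^ (2 * expoW κ M)) := by gcongr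
        _ = Λ * C0W κ M * r ^ (2 * expoW κ M) * (sigW κ M T t * rho T t ^ (2 * expoW κ M)) := by
            rw [hsplit]; ring
        _ = Λ * C0W κ M * r ^ (2 * m) := by rw [h1, mul_one]
    · simp only [barrierW, one_mul]
      have hρρ : ρ₀ ≤ rho T t := by
        rw [hρ₀_def]; unfold rho
        apply exp_le_exp.2
        have : log (T - t) ≤ log (T - 0) := log_le_log hs (by linarith [ht.1])
        linarith
      have hb := profW_ge_rpow hκ0 hκ1 hM hρ₀ hρρ
      have h1 := sigW_mul_rho_rpow κ M T t
      calc (1 : ℝ) ≤ Λ * κ₁ := by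
              rw [← div_le_iff₀ hκ₁]; exact hΛ1
        _ = Λ * (sigW κ M T t * (κ₁ * rho T t ^ (2 * expoW κ M))) := by
              rw [show sigW κ M T t * (κ₁ * rho T t ^ (2 * expoW κ M))
                  = κ₁ * (sigW κ M T t * rho T t ^ (2 * expoW κ M)) by ring, h1, mul_one]
        _ ≤ Λ * (sigW κ M T t * profW κ M (rho T t)) := by gcongr
        _ = Λ * sigW κ M T t * profW κ M (rho T t) := by ring
  · intro r hr
    simp only [barrierW]
    have hξ0 : 0 ≤ r * ρ₀ := by have := hr.1; positivity
    have hξ2 : r * ρ₀ ≤ 2 * ρ₀ := by have := hr.2; nlinarith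
    have hb := profW_ge_sq hκ0 hκ1 hM (by positivity : 0 < 2 * ρ₀) hξ0 hξ2
    have hρsq : ρ₀ ^ 2 = T⁻¹ := by rw [hρ₀_def, rho_sq (by linarith : 0 < T - 0)]; simp
    have hmin : min r 1 ^ 2 ≤ r ^ 2 := by
      have h0 : 0 ≤ min r 1 := le_min hr.1 zero_le_one
      exact pow_le_pow_left₀ h0 (min_le_left r 1) 2
    have hmain : r ^ 2 ≤ Λ * σ₀ * profW κ M (r * ρ₀) := by
      calc r ^ 2 = (T / (σ₀ * κ₂)) * σ₀ * (κ₂ * (r ^ 2 * T⁻¹)) := by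
              field_simp
            _ ≤ Λ * σ₀ * (κ₂ * (r ^ 2 * T⁻¹)) := by gcongr
            _ = Λ * σ₀ * (κ₂ * (r * ρ₀) ^ 2) := by rw [mul_pow, hρsq]
            _ ≤ Λ * σ₀ * profW κ M (r * ρ₀) := by gcongr
    exact hmin.trans hmain
  · intro r hr t ht
    exact barrierW_pde hκ0 hκ1 hM hΛ hr.1 ht.2

end Summit.NavierStokesRegularity.NavierStokesRegularity.Theorems.ZhangBarrier

namespace Summit.NavierStokesRegularity.NavierStokesRegularity.Theorems

open Literature.Analysis.FluidPDE

/-- **The κ-inflow criterion, unconditional** (ideator line `kappa-inflow`, ns-idea-4: its only open stub O1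
`HalfLineBarrierAt κ M T` is now the explicit barrier `ZhangBarrier.exists_halfLineBarrierW`).  For every
`κ ∈ (0,1]`, `M > 0`, `ν > 0`, `T > 0`: an axisymmetric classical Leray–Hopf solution on `[0,T)` at viscosity `ν`
from a rapidly decaying datum whose radial velocity obeys `u_r ≥ −M ν^{1−κ/2} r^{κ−1} (T−t)^{−κ/2}` on the unit
tube `0 < r ≤ 1` extends smoothly past `T`.  Proof: `RadialInflowComparisonT.hasSmoothExtensionPast_of_kappaEnvelope`
(p819758) + `ZhangBarrier.exists_halfLineBarrierW κ M (νT)` + `RadialInflowComparisonT.exists_bound_subslab`.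
[new; at κ = 1 cite: Zhang2026PartialTypeI, Thm. 1.1] -/
theorem hasSmoothExtensionPast_of_kappaEnvelope_holds {κ M ν T : ℝ}
    {u : ℝ → EuclideanSpace ℝ (Fin 3) → EuclideanSpace ℝ (Fin 3)} {p : ℝ → EuclideanSpace ℝ (Fin 3) → ℝ}
    (hκ0 : 0 < κ) (hκ1 : κ ≤ 1) (hM : 0 < M) (hν : 0 < ν) (hT : 0 < T)
    (hcl : IsClassicalNSSolutionOn (Ico 0 T) ν 0 u p) (hLH : IsLerayHopfOn T ν 0 (u 0) u)
    (hdec : HasRapidSpatialDecay (u 0)) (hax : ∀ t ∈ Ico 0 T, IsAxisymmetric (u t))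
    (henv : ∀ t ∈ Ico 0 T, ∀ x : EuclideanSpace ℝ (Fin 3), 0 < cylRadius x → cylRadius x ≤ 1 →
      -(M * ν ^ (1 - κ / 2) * cylRadius x ^ (κ - 1) * (T - t) ^ (-(κ / 2))) ≤ radialVelocity (u t) x) :
    HasSmoothExtensionPast ν 0 u T :=
  RadialInflowComparisonT.hasSmoothExtensionPast_of_kappaEnvelope hν hT
    (ZhangBarrier.exists_halfLineBarrierW κ M (ν * T) hκ0 hκ1 hM (by positivity)) hcl hLH hdec
    (RadialInflowComparisonT.exists_bound_subslab hν hT hcl hLH hdec) hax henv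

end Summit.NavierStokesRegularity.NavierStokesRegularity.Theorems

end
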